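import Mathlib.AlgebraicGeometry.EllipticCurve.Affine.Point
import HarnessLib

/-!
# Halving the `2`-torsion of the Legendre curve: explicit points `T` with `2T = (0,0)`, `2T = (1,0)`

Silverman, *AEC* X.1 Prop. 1.4 (the halving criterion: for `y² = (x−e₁)(x−e₂)(x−e₃)` a point `(x₀, y₀)` lies in
`2E(K)` iff all `x₀ − eᵢ` are squares in `K`), specialised to the Legendre equation `E_λ : y² = x(x−1)(x−λ)` (the
tree's `⟨0, −(1+λ), 0, λ, 0⟩`, cf. `NFPoint.legendreCurve`, `Cor22.thetaCurve`) and its `2`-torsion points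
`(0,0)`, `(1,0)`:

* `legendre_nonsingular_sqrt` / `legendre_two_smul_sqrt` — for `a² = λ`, `i² = −1` (`λ ≠ 0, 1`, `2 ≠ 0`) the point
  `T_a := (a, i·a·(a−1))` lies on `E_λ` and `T_a + T_a = (0, 0)` (tangent slope `i(a−1)`); so `T_a ∈ E_λ[4]` and
  `√λ = x(T_a)`;
* `legendre_nonsingular_one_add` / `legendre_two_smul_one_add` — for `s² = 1 − λ` the point
  `T_s := (1 + s, s·(1 + s))` lies on `E_λ` and `T_s + T_s = (1, 0)` (tangent slope `1 + s`); so `T_s ∈ E_λ[4]`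
  and `√(1−λ) = x(T_s) − 1` (`= √−1·√(λ−1)` up to sign).

Hence `F(E_λ[4]) ⊇ F(√−1, √λ, √(λ−1))` coordinate-wise — the form in which the abc-iut cell's reading-v3 field
`F‡ = F_tpd(√−1, √λ, √(λ−1), E_λ[3·5])` is generated over `F_tpd` by a root of unity (`√−1`) and TORSION
COORDINATES of `E_λ` (`a = x(T_a)`, `1 + s = x(T_s)`, the `15`-torsion coordinates) — the hypothesis shape of
abc-iut-S-d1's `Cor22.ramificationIdx_eq_one_of_adjoin_legendreTorsion` (unramified at the good places of `λ`).
PROOF-ONLY; pure algebra over any field with `2 ≠ 0`. [cite: SilvermanAEC2009, X.1 Prop 1.4 p.315]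
-/

namespace WeierstrassCurve.Affine

variable {F : Type*} [Field F] [DecidableEq F] [NeZero (2 : F)]

omit [DecidableEq F] [NeZero (2 : F)] in
/-- `(0, 0)` is a nonsingular point of `E_λ` (`λ ≠ 0`). [cite: SilvermanAEC2009, III.1 p.42] -/
theorem legendre_nonsingular_zero {t : F} (h0 : t ≠ 0) :
    (⟨0, -(1 + t), 0, t, 0⟩ : WeierstrassCurve F).toAffine.Nonsingular 0 0 := by
  rw [nonsingular_iff']
  refine ⟨by rw [equation_iff']; ring, Or.inl ?_⟩
  have e : (0 : F) * 0 - (3 * 0 ^ 2 + 2 * -(1 + t) * 0 + t) = -t := by ring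
  rw [e]; exact neg_ne_zero.2 h0

omit [DecidableEq F] [NeZero (2 : F)] in
/-- `(1, 0)` is a nonsingular point of `E_λ` (`λ ≠ 1`). [cite: SilvermanAEC2009, III.1 p.42] -/
theorem legendre_nonsingular_one {t : F} (h1 : t ≠ 1) :
    (⟨0, -(1 + t), 0, t, 0⟩ : WeierstrassCurve F).toAffine.Nonsingular 1 0 := by
  rw [nonsingular_iff']
  refine ⟨by rw [equation_iff']; ring, Or.inl ?_⟩
  have e : (0 : F) * 0 - (3 * 1 ^ 2 + 2 * -(1 + t) * 1 + t) = t - 1 := by ring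
  rw [e]; exact sub_ne_zero.2 h1

omit [DecidableEq F] in
/-- **`T_a = (a, i·a·(a−1))` lies on `E_λ` (and is nonsingular)** when `a² = λ`, `i² = −1`, `λ ≠ 0, 1`:
`(i a (a−1))² = −a²(a−1)² = a(a−1)(a−a²)`. [cite: SilvermanAEC2009, X.1 Prop 1.4 p.315] -/
theorem legendre_nonsingular_sqrt {t a i : F} (ha : a ^ 2 = t) (hi : i ^ 2 = -1) (h0 : t ≠ 0) (h1 : t ≠ 1) :
    (⟨0, -(1 + t), 0, t, 0⟩ : WeierstrassCurve F).toAffine.Nonsingular a (i * a * (a - 1)) := by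
  have ha0 : a ≠ 0 := by rintro rfl; apply h0; rw [← ha]; ring
  have ha1 : a - 1 ≠ 0 := by
    intro h; apply h1; rw [sub_eq_zero] at h; rw [← ha, h]; ring
  have hi0 : i ≠ 0 := by rintro rfl; norm_num at hi
  rw [nonsingular_iff']
  refine ⟨?_, Or.inr ?_⟩
  · rw [equation_iff', ← ha]
    linear_combination (a ^ 2 * (a - 1) ^ 2) * hi
  · have e : (2 : F) * (i * a * (a - 1)) + 0 * a + 0 = 2 * (i * a * (a - 1)) := by ring
    rw [e]
    exact mul_ne_zero two_ne_zero (mul_ne_zero (mul_ne_zero hi0 ha0) ha1)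

/-- **Halving `(0,0)`: `T_a + T_a = (0, 0)`** for `T_a = (a, i·a·(a−1))`, `a² = λ`, `i² = −1` — the tangent at `T_a`
has slope `i(a−1)` and meets `E_λ` again at `(0,0)`. So `T_a` is a `4`-torsion point with `x(T_a) = √λ`.
[cite: SilvermanAEC2009, X.1 Prop 1.4 p.315] -/
theorem legendre_two_smul_sqrt {t a i : F} (ha : a ^ 2 = t) (hi : i ^ 2 = -1) (h0 : t ≠ 0) (h1 : t ≠ 1) :
    Point.some a (i * a * (a - 1)) (legendre_nonsingular_sqrt ha hi h0 h1) +
        Point.some a (i * a * (a - 1)) (legendre_nonsingular_sqrt ha hi h0 h1) =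
      Point.some 0 0 (legendre_nonsingular_zero h0) := by
  have ha0 : a ≠ 0 := by rintro rfl; apply h0; rw [← ha]; ring
  have ha1 : a - 1 ≠ 0 := by
    intro h; apply h1; rw [sub_eq_zero] at h; rw [← ha, h]; ring
  have hi0 : i ≠ 0 := by rintro rfl; norm_num at hi
  have h2y : (2 : F) * (i * a * (a - 1)) ≠ 0 := mul_ne_zero two_ne_zero (mul_ne_zero (mul_ne_zero hi0 ha0) ha1)
  have hy : i * a * (a - 1) ≠ (⟨0, -(1 + t), 0, t, 0⟩ : WeierstrassCurve F).toAffine.negY a (i * a * (a - 1)) := by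
    intro h
    apply h2y
    simp only [negY] at h
    linear_combination h
  have hden : i * a * (a - 1) - (⟨0, -(1 + t), 0, t, 0⟩ : WeierstrassCurve F).toAffine.negY a (i * a * (a - 1)) ≠ 0 :=
    sub_ne_zero.2 hy
  have hslope : (⟨0, -(1 + t), 0, t, 0⟩ : WeierstrassCurve F).toAffine.slope a a (i * a * (a - 1)) (i * a * (a - 1))
      = i * (a - 1) := by
    rw [slope_of_Y_ne rfl hy, div_eq_iff hden]
    simp only [negY]
    rw [← ha]
    linear_combination (-2 * a * (a - 1) ^ 2) * hi
  rw [Point.add_self_of_Y_ne hy, Point.some.injEq, hslope]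
  refine ⟨?_, ?_⟩
  · simp only [addX]
    rw [← ha]
    linear_combination ((a - 1) ^ 2) * hi
  · simp only [addY, negAddY, addX, negY]
    rw [← ha]
    linear_combination (-(i * (a - 1) ^ 3)) * hi

omit [DecidableEq F] in
/-- **`T_s = (1 + s, s·(1+s))` lies on `E_λ` (and is nonsingular)** when `s² = 1 − λ`, `λ ≠ 0, 1`:
`(s(1+s))² = (1+s)·s·(1+s−λ)` as `1 + s − λ = s(1+s)`. [cite: SilvermanAEC2009, X.1 Prop 1.4 p.315] -/
theorem legendre_nonsingular_one_add {t s : F} (hs : s ^ 2 = 1 - t) (h0 : t ≠ 0) (h1 : t ≠ 1) :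
    (⟨0, -(1 + t), 0, t, 0⟩ : WeierstrassCurve F).toAffine.Nonsingular (1 + s) (s * (1 + s)) := by
  have hs0 : s ≠ 0 := by rintro rfl; apply h1; linear_combination hs
  have hs1 : 1 + s ≠ 0 := by
    intro h
    have hs' : s = -1 := by linear_combination h
    apply h0; rw [hs'] at hs; linear_combination hs
  have ht : t = 1 - s ^ 2 := by rw [hs]; ring
  rw [nonsingular_iff']
  refine ⟨?_, Or.inr ?_⟩
  · rw [equation_iff', ht]
    ring
  · have e : (2 : F) * (s * (1 + s)) + 0 * (1 + s) + 0 = 2 * (s * (1 + s)) := by ring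
    rw [e]
    exact mul_ne_zero two_ne_zero (mul_ne_zero hs0 hs1)

/-- **Halving `(1,0)`: `T_s + T_s = (1, 0)`** for `T_s = (1 + s, s(1+s))`, `s² = 1 − λ` — the tangent at `T_s` has
slope `1 + s` and meets `E_λ` again at `(1,0)`. So `T_s` is a `4`-torsion point with `x(T_s) − 1 = s`, a square
root of `1 − λ`. [cite: SilvermanAEC2009, X.1 Prop 1.4 p.315] -/
theorem legendre_two_smul_one_add {t s : F} (hs : s ^ 2 = 1 - t) (h0 : t ≠ 0) (h1 : t ≠ 1) :
    Point.some (1 + s) (s * (1 + s)) (legendre_nonsingular_one_add hs h0 h1) +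
        Point.some (1 + s) (s * (1 + s)) (legendre_nonsingular_one_add hs h0 h1) =
      Point.some 1 0 (legendre_nonsingular_one h1) := by
  have hs0 : s ≠ 0 := by rintro rfl; apply h1; linear_combination hs
  have hs1 : 1 + s ≠ 0 := by
    intro h
    have hs' : s = -1 := by linear_combination h
    apply h0; rw [hs'] at hs; linear_combination hs
  have ht : t = 1 - s ^ 2 := by rw [hs]; ring
  have h2y : (2 : F) * (s * (1 + s)) ≠ 0 := mul_ne_zero two_ne_zero (mul_ne_zero hs0 hs1)
  have hy : s * (1 + s) ≠ (⟨0, -(1 + t), 0, t, 0⟩ : WeierstrassCurve F).toAffine.negY (1 + s) (s * (1 + s)) := by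
    intro h
    apply h2y
    simp only [negY] at h
    linear_combination h
  have hden : s * (1 + s) - (⟨0, -(1 + t), 0, t, 0⟩ : WeierstrassCurve F).toAffine.negY (1 + s) (s * (1 + s)) ≠ 0 :=
    sub_ne_zero.2 hy
  have hslope : (⟨0, -(1 + t), 0, t, 0⟩ : WeierstrassCurve F).toAffine.slope (1 + s) (1 + s) (s * (1 + s)) (s * (1 + s))
      = 1 + s := by
    rw [slope_of_Y_ne rfl hy, div_eq_iff hden]
    simp only [negY]
    rw [ht]
    ring
  rw [Point.add_self_of_Y_ne hy, Point.some.injEq, hslope]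
  refine ⟨?_, ?_⟩
  · simp only [addX]
    rw [ht]
    ring
  · simp only [addY, negAddY, addX, negY]
    rw [ht]
    ring

/-! ## Hence `4`-torsion -/

omit [NeZero (2 : F)] in
/-- `(0,0) + (0,0) = 𝒪`: the `2`-torsion point `(0, 0)` of `E_λ`. [cite: SilvermanAEC2009, III.1 p.42] -/
theorem legendre_two_smul_zero {t : F} (h0 : t ≠ 0) :
    Point.some 0 0 (legendre_nonsingular_zero h0) + Point.some 0 0 (legendre_nonsingular_zero h0) =
      (0 : (⟨0, -(1 + t), 0, t, 0⟩ : WeierstrassCurve F).toAffine.Point) :=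
  Point.add_self_of_Y_eq (by simp [negY])

omit [NeZero (2 : F)] in
/-- `(1,0) + (1,0) = 𝒪`: the `2`-torsion point `(1, 0)` of `E_λ`. [cite: SilvermanAEC2009, III.1 p.42] -/
theorem legendre_two_smul_one {t : F} (h1 : t ≠ 1) :
    Point.some 1 0 (legendre_nonsingular_one h1) + Point.some 1 0 (legendre_nonsingular_one h1) =
      (0 : (⟨0, -(1 + t), 0, t, 0⟩ : WeierstrassCurve F).toAffine.Point) :=
  Point.add_self_of_Y_eq (by simp [negY])

/-- **`4 • T_a = 𝒪`**: `T_a = (a, i·a·(a−1))` is a `4`-torsion point of `E_λ` (`a² = λ`, `i² = −1`) — the form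
`(n : ℤ) • T = 0` with `n = 4` invertible at every odd place, as consumed by unramifiedness-at-good-places lemmas for
fields generated by torsion coordinates. [cite: SilvermanAEC2009, X.1 Prop 1.4 p.315] -/
theorem legendre_four_smul_sqrt {t a i : F} (ha : a ^ 2 = t) (hi : i ^ 2 = -1) (h0 : t ≠ 0) (h1 : t ≠ 1) :
    (4 : ℤ) • Point.some a (i * a * (a - 1)) (legendre_nonsingular_sqrt ha hi h0 h1) = 0 := by
  have h2 : (2 : ℤ) • Point.some a (i * a * (a - 1)) (legendre_nonsingular_sqrt ha hi h0 h1) =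
      Point.some 0 0 (legendre_nonsingular_zero h0) := by
    rw [two_zsmul]; exact legendre_two_smul_sqrt ha hi h0 h1
  rw [show (4 : ℤ) = 2 * 2 by norm_num, mul_zsmul, h2, two_zsmul]
  exact legendre_two_smul_zero h0

/-- **`4 • T_s = 𝒪`**: `T_s = (1 + s, s(1+s))` is a `4`-torsion point of `E_λ` (`s² = 1 − λ`).
[cite: SilvermanAEC2009, X.1 Prop 1.4 p.315] -/
theorem legendre_four_smul_one_add {t s : F} (hs : s ^ 2 = 1 - t) (h0 : t ≠ 0) (h1 : t ≠ 1) :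
    (4 : ℤ) • Point.some (1 + s) (s * (1 + s)) (legendre_nonsingular_one_add hs h0 h1) = 0 := by
  have h2 : (2 : ℤ) • Point.some (1 + s) (s * (1 + s)) (legendre_nonsingular_one_add hs h0 h1) =
      Point.some 1 0 (legendre_nonsingular_one h1) := by
    rw [two_zsmul]; exact legendre_two_smul_one_add hs h0 h1
  rw [show (4 : ℤ) = 2 * 2 by norm_num, mul_zsmul, h2, two_zsmul]
  exact legendre_two_smul_one h1

end WeierstrassCurve.Affine
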